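import Summits.KontsevichZagierPeriods.KontsevichZagierPeriods.Theorems.SymplecticScissorsPlanarCompilerStubSignedSweepAux2
import Summits.KontsevichZagierPeriods.KontsevichZagierPeriods.Theorems.SymplecticScissorsPlanarCompilerStubSignedSweepAux4
import Literature.ModelTheory.ExponentialFields.SemialgebraicDimension
import Literature.NumberTheory.Transcendental.KZLogCalculusProofs

/-!
# Signed sweep of the triangle, helper V: the sweep of one strip

Helper file for the stub `stub_signedSweep` of the line `twist-restoring-shear` (crux
`PlanarCompiler`, route `SymplecticScissors`). Over an open strip `(u, v) ⊆ (0, 1)` carrying the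
sections of a cylindrical decomposition adapted to the open triangle `T` and to three further sets
`W, P, N` (with `T ∖ W` null), each section being constant or strictly monotone on the strip, we
produce the levels of the sweep: boundary functions `bnd 0 = 0 < bnd 1 < ⋯ < bnd L = 1 - t` on the
strip, continuous and monotone on the closed strip (extension by one-sided limits), `ℚ`-semialgebraic
on the open strip, whose open cells lie in `T` and in `W`, carry a sign with respect to `P, N`, and
cover `T` over the strip up to the (null) graphs.
-/

noncomputable section

open MeasureTheory Set Filter Topology
open Literature.NumberTheory.Transcendental Literature.ModelTheory.ExponentialFields

namespace Summit.KontsevichZagierPeriods.SymplecticScissors.PlanarCompilerProof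

variable {n : ℕ}

/-- **The sweep of one strip.** See the module docstring. [folklore] -/
theorem stub_signedSweep_stripSweep :
    ∀ {n : ℕ} {W P N : Set (Fin 2 → ℝ)} {u v : ℝ}, 0 ≤ u → u < v → v ≤ 1 →
    ∀ {ξ : Fin n → (Fin 1 → ℝ) → ℝ},
    (∀ j, ContinuousOn (ξ j) {z : Fin 1 → ℝ | z 0 ∈ Ioo u v}) →
    (∀ j, IsSemialgebraicFunOn ℚ {z : Fin 1 → ℝ | z 0 ∈ Ioo u v} (ξ j)) →
    (∀ z : Fin 1 → ℝ, z 0 ∈ Ioo u v → StrictMono fun j => ξ j z) →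
    (∀ j, (∃ c, EqOn (fun t : ℝ => ξ j (fun _ => t)) (fun _ => c) (Ioo u v)) ∨
      StrictMonoOn (fun t : ℝ => ξ j (fun _ => t)) (Ioo u v) ∨
      StrictAntiOn (fun t : ℝ => ξ j (fun _ => t)) (Ioo u v)) →
    (∀ z : Fin 1 → ℝ, z 0 ∈ Ioo u v → ∀ t : ℝ,
      (∃ j, t = ξ j z) ∨ ∃ j : Fin (n + 1), bandLower ξ j z < (t : EReal) ∧ (t : EReal) < bandUpper ξ j z) →
    (∀ j : Fin (n + 1),
      bandOver {z : Fin 1 → ℝ | z 0 ∈ Ioo u v} ξ j ⊆ {p : Fin 2 → ℝ | 0 < p 0 ∧ 0 < p 1 ∧ p 0 + p 1 < 1} ∨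
      Disjoint (bandOver {z : Fin 1 → ℝ | z 0 ∈ Ioo u v} ξ j) {p : Fin 2 → ℝ | 0 < p 0 ∧ 0 < p 1 ∧ p 0 + p 1 < 1}) →
    (∀ j : Fin n,
      graphOver {z : Fin 1 → ℝ | z 0 ∈ Ioo u v} (ξ j) ⊆ {p : Fin 2 → ℝ | 0 < p 0 ∧ 0 < p 1 ∧ p 0 + p 1 < 1} ∨
      Disjoint (graphOver {z : Fin 1 → ℝ | z 0 ∈ Ioo u v} (ξ j)) {p : Fin 2 → ℝ | 0 < p 0 ∧ 0 < p 1 ∧ p 0 + p 1 < 1}) →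
    (∀ j : Fin (n + 1), bandOver {z : Fin 1 → ℝ | z 0 ∈ Ioo u v} ξ j ⊆ W ∨
      Disjoint (bandOver {z : Fin 1 → ℝ | z 0 ∈ Ioo u v} ξ j) W) →
    (∀ j : Fin (n + 1), bandOver {z : Fin 1 → ℝ | z 0 ∈ Ioo u v} ξ j ⊆ P ∨
      Disjoint (bandOver {z : Fin 1 → ℝ | z 0 ∈ Ioo u v} ξ j) P) →
    (∀ j : Fin (n + 1), bandOver {z : Fin 1 → ℝ | z 0 ∈ Ioo u v} ξ j ⊆ N ∨
      Disjoint (bandOver {z : Fin 1 → ℝ | z 0 ∈ Ioo u v} ξ j) N) →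
    volume ({p : Fin 2 → ℝ | 0 < p 0 ∧ 0 < p 1 ∧ p 0 + p 1 < 1} \ W) = 0 →
    ∃ (L : ℕ) (bnd : ℕ → ℝ → ℝ), 0 < L ∧
      (∀ t ∈ Icc u v, bnd 0 t = 0) ∧
      (∀ t ∈ Icc u v, bnd L t = 1 - t) ∧
      (∀ l, l ≤ L → ContinuousOn (bnd l) (Icc u v)) ∧
      (∀ l, l ≤ L → (MonotoneOn (bnd l) (Icc u v) ∨ AntitoneOn (bnd l) (Icc u v))) ∧
      (∀ l, l < L → ∀ t ∈ Ioo u v, bnd l t < bnd (l + 1) t) ∧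
      (∀ l, l ≤ L → IsSemialgebraicFunOn ℚ {z : Fin 1 → ℝ | z 0 ∈ Ioo u v} (fun z => bnd l (z 0))) ∧
      (∀ l, l < L → IsOpen {p : Fin 2 → ℝ | p 0 ∈ Ioo u v ∧ bnd l (p 0) < p 1 ∧ p 1 < bnd (l + 1) (p 0)}) ∧
      (∀ l, l < L → IsSemialgebraic ℚ
        {p : Fin 2 → ℝ | p 0 ∈ Ioo u v ∧ bnd l (p 0) < p 1 ∧ p 1 < bnd (l + 1) (p 0)}) ∧
      (∀ l, l < L → {p : Fin 2 → ℝ | p 0 ∈ Ioo u v ∧ bnd l (p 0) < p 1 ∧ p 1 < bnd (l + 1) (p 0)} ⊆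
        {p : Fin 2 → ℝ | 0 < p 0 ∧ 0 < p 1 ∧ p 0 + p 1 < 1}) ∧
      (∀ l, l < L → {p : Fin 2 → ℝ | p 0 ∈ Ioo u v ∧ bnd l (p 0) < p 1 ∧ p 1 < bnd (l + 1) (p 0)} ⊆ W) ∧
      (∀ l, l < L →
        ({p : Fin 2 → ℝ | p 0 ∈ Ioo u v ∧ bnd l (p 0) < p 1 ∧ p 1 < bnd (l + 1) (p 0)} ⊆ P ∨
         {p : Fin 2 → ℝ | p 0 ∈ Ioo u v ∧ bnd l (p 0) < p 1 ∧ p 1 < bnd (l + 1) (p 0)} ⊆ N ∨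
         (Disjoint {p : Fin 2 → ℝ | p 0 ∈ Ioo u v ∧ bnd l (p 0) < p 1 ∧ p 1 < bnd (l + 1) (p 0)} P ∧
          Disjoint {p : Fin 2 → ℝ | p 0 ∈ Ioo u v ∧ bnd l (p 0) < p 1 ∧ p 1 < bnd (l + 1) (p 0)} N))) ∧
      volume ({p : Fin 2 → ℝ | p 0 ∈ Ioo u v ∧ 0 < p 1 ∧ p 0 + p 1 < 1} \
        ⋃ (l : ℕ) (_ : l < L), {p : Fin 2 → ℝ | p 0 ∈ Ioo u v ∧ bnd l (p 0) < p 1 ∧ p 1 < bnd (l + 1) (p 0)}) = 0 := by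
  intro n W P N u v hu huv hv ξ hcont hsa hmono hshape hpart hTb hTg hWb hPb hNb hnull
  set S' : Set (Fin 1 → ℝ) := {z : Fin 1 → ℝ | z 0 ∈ Ioo u v} with hS'
  set T : Set (Fin 2 → ℝ) := {p : Fin 2 → ℝ | 0 < p 0 ∧ 0 < p 1 ∧ p 0 + p 1 < 1} with hT
  obtain ⟨j0, j1, hj01, hξ0, hξ1, hbet⟩ := stub_signedSweep_stripSections hu huv hv hmono hpart hTb hTg
  have hj1n : (j1 : ℕ) < n := j1.isLt
  have hj01v : (j0 : ℕ) < j1 := Fin.lt_def.1 hj01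
  have hS'open : IsOpen S' := isOpen_Ioo.preimage (continuous_apply 0)
  have hS'sa : IsSemialgebraic ℚ S' := by
    cases n with
    | zero => exact absurd hj1n (Nat.not_lt_zero _)
    | succ m => exact IsSemialgebraicFunOn.isSemialgebraic_holds (hsa 0)
  have hconst : ∀ t : ℝ, ((fun _ : Fin 1 => t) : Fin 1 → ℝ) ∈ S' ↔ t ∈ Ioo u v := fun t => Iff.rfl
  have hself : ∀ z : Fin 1 → ℝ, (fun _ : Fin 1 => z 0) = z := fun z =>
    funext fun i => by rw [Subsingleton.elim i 0]
  have hinit : ∀ p : Fin 2 → ℝ, Fin.init p = fun _ : Fin 1 => p 0 := fun p =>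
    funext fun i => by rw [Subsingleton.elim i 0]; rfl
  -- ℕ-indexed sections as real functions, and the boundary functions of the levels
  set sec : ℕ → ℝ → ℝ := fun i t => if h : i < n then ξ ⟨i, h⟩ (fun _ => t) else 0 with hsec
  have hsec_eq : ∀ (i : ℕ) (h : i < n), sec i = fun t => ξ ⟨i, h⟩ (fun _ => t) := fun i h => by
    funext t; simp [hsec, h]
  set L : ℕ := j1 - j0 with hL
  have hLpos : 0 < L := by omega
  have hidx : ∀ l, l ≤ L → (j0 : ℕ) + l < n := fun l hl => by omega
  set bnd : ℕ → ℝ → ℝ := fun l => extendFrom (Ioo u v) (sec (j0 + l)) with hbnd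
  -- the extension lemma applied to each level
  have hspec : ∀ l (hl : l ≤ L), ContinuousOn (bnd l) (Icc u v) ∧
      (MonotoneOn (bnd l) (Icc u v) ∨ AntitoneOn (bnd l) (Icc u v)) ∧
      EqOn (bnd l) (fun t => ξ ⟨j0 + l, hidx l hl⟩ (fun _ => t)) (Ioo u v) := by
    intro l hl
    have hfun := hsec_eq (j0 + l) (hidx l hl)
    have hb : bnd l = extendFrom (Ioo u v) (fun t => ξ ⟨j0 + l, hidx l hl⟩ (fun _ => t)) := by
      show extendFrom (Ioo u v) (sec (j0 + l)) = _
      rw [hfun]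
    have hc : ContinuousOn (fun t : ℝ => ξ ⟨j0 + l, hidx l hl⟩ (fun _ => t)) (Ioo u v) :=
      (hcont _).comp (continuous_pi fun _ => continuous_id).continuousOn fun t ht => ht
    have hbd : ∀ t ∈ Ioo u v, (0 : ℝ) ≤ ξ ⟨j0 + l, hidx l hl⟩ (fun _ => t) ∧
        ξ ⟨j0 + l, hidx l hl⟩ (fun _ => t) ≤ 1 := by
      intro t ht
      have hz : ((fun _ : Fin 1 => t) : Fin 1 → ℝ) ∈ S' := ht
      have hm := (hmono (fun _ : Fin 1 => t) ht).monotone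
      constructor
      · have h := hm (show j0 ≤ ⟨j0 + l, hidx l hl⟩ from Fin.le_def.2 (by simp))
        simp only at h
        rwa [hξ0 _ hz] at h
      · have h := hm (show (⟨j0 + l, hidx l hl⟩ : Fin n) ≤ j1 from Fin.le_def.2 (by simp; omega))
        simp only at h
        rw [hξ1 _ hz] at h
        have : (0 : ℝ) ≤ t := hu.trans ht.1.le
        have : (fun _ : Fin 1 => t) 0 = t := rfl
        linarith
    rw [hb]
    exact extendFrom_Ioo_spec huv hc (hshape _) hbd
  -- identification of the cells with bands
  have cell_eq : ∀ l, l < L → ∀ j : Fin (n + 1), (j : ℕ) = j0 + l + 1 →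
      {p : Fin 2 → ℝ | p 0 ∈ Ioo u v ∧ bnd l (p 0) < p 1 ∧ p 1 < bnd (l + 1) (p 0)} = bandOver S' ξ j := by
    intro l hl j hj
    have hne0 : j ≠ 0 := fun h => by rw [h] at hj; simp at hj
    have hnel : j ≠ Fin.last n := fun h => by rw [h, Fin.val_last] at hj; omega
    have hpred : j.pred hne0 = ⟨j0 + l, hidx l hl.le⟩ :=
      Fin.ext (by rw [Fin.val_pred]; show (j : ℕ) - 1 = j0 + l; omega)
    have hcp : j.castPred hnel = ⟨j0 + (l + 1), hidx (l + 1) hl⟩ :=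
      Fin.ext (by rw [Fin.coe_castPred]; show (j : ℕ) = j0 + (l + 1); omega)
    ext p
    rw [mem_bandOver_iff, bandLower_of_ne_zero ξ j hne0, bandUpper_of_ne_last ξ j hnel,
      EReal.coe_lt_coe_iff, EReal.coe_lt_coe_iff, hinit, hpred, hcp]
    simp only [mem_setOf_eq]
    constructor
    · rintro ⟨h0, h1, h2⟩
      have e1 : bnd l (p 0) = ξ ⟨j0 + l, hidx l hl.le⟩ (fun _ => p 0) := (hspec l hl.le).2.2 h0
      have e2 : bnd (l + 1) (p 0) = ξ ⟨j0 + (l + 1), hidx (l + 1) hl⟩ (fun _ => p 0) :=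
        (hspec (l + 1) hl).2.2 h0
      refine ⟨h0, ?_, ?_⟩
      · rw [← e1]; exact h1
      · rw [← e2]; exact h2
    · rintro ⟨h0, h1, h2⟩
      have h0' : p 0 ∈ Ioo u v := h0
      have e1 : bnd l (p 0) = ξ ⟨j0 + l, hidx l hl.le⟩ (fun _ => p 0) := (hspec l hl.le).2.2 h0'
      have e2 : bnd (l + 1) (p 0) = ξ ⟨j0 + (l + 1), hidx (l + 1) hl⟩ (fun _ => p 0) :=
        (hspec (l + 1) hl).2.2 h0'
      refine ⟨h0', ?_, ?_⟩
      · rw [e1]; exact h1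
      · rw [e2]; exact h2
  -- the band index of a level
  have hband : ∀ l, l < L → ∃ j : Fin (n + 1), (j : ℕ) = j0 + l + 1 ∧ j0.succ ≤ j ∧ j ≤ j1.castSucc :=
    fun l hl => ⟨⟨j0 + l + 1, by omega⟩, rfl, Fin.le_def.2 (by simp),
      Fin.le_def.2 (by simp; omega)⟩
  -- strict monotonicity of consecutive levels on the open strip
  have hlt : ∀ l, l < L → ∀ t ∈ Ioo u v, bnd l t < bnd (l + 1) t := by
    intro l hl t ht
    rw [(hspec l hl.le).2.2 ht, (hspec (l + 1) hl).2.2 ht]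
    exact hmono _ ht (Fin.lt_def.2 (by simp))
  refine ⟨L, bnd, hLpos, ?_, ?_, fun l hl => (hspec l hl).1, fun l hl => (hspec l hl).2.1, hlt, ?_, ?_,
    ?_, ?_, ?_, ?_, ?_⟩
  · -- `bnd 0 = 0`
    intro t ht
    refine extendFrom_Ioo_eq_of_eqOn (g := fun _ => (0 : ℝ)) huv (fun s hs => ?_) continuous_const t ht
    rw [hsec_eq _ (hidx 0 (Nat.zero_le _))]
    exact hξ0 _ hs
  · -- `bnd L = 1 - t`
    intro t ht
    refine extendFrom_Ioo_eq_of_eqOn (g := fun s : ℝ => 1 - s) huv (fun s hs => ?_)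
      (continuous_const.sub continuous_id) t ht
    rw [hsec_eq _ (hidx L le_rfl)]
    have : (⟨j0 + L, hidx L le_rfl⟩ : Fin n) = j1 := Fin.ext (by simp; omega)
    simp only [this]
    exact hξ1 _ hs
  · -- semialgebraic on the open strip
    intro l hl
    refine (hsa ⟨j0 + l, hidx l hl⟩).congr fun z hz => ?_
    have hz' : z 0 ∈ Ioo u v := hz
    show ξ ⟨j0 + l, hidx l hl⟩ z = bnd l (z 0)
    rw [(hspec l hl).2.2 hz']
    show ξ ⟨j0 + l, hidx l hl⟩ z = ξ ⟨j0 + l, hidx l hl⟩ (fun _ => z 0)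
    rw [hself z]
  · -- open
    intro l hl
    obtain ⟨j, hj, -, -⟩ := hband l hl
    rw [cell_eq l hl j hj]
    exact isOpen_bandOver hS'open hcont j
  · -- semialgebraic cells
    intro l hl
    obtain ⟨j, hj, -, -⟩ := hband l hl
    rw [cell_eq l hl j hj]
    exact isSemialgebraic_bandOver' hS'sa hsa j
  · -- inside `T`
    intro l hl
    obtain ⟨j, hj, h1, h2⟩ := hband l hl
    rw [cell_eq l hl j hj]
    exact hbet j h1 h2
  · -- inside `W`: a band of positive area cannot lie in the null set `T \ W`
    intro l hl
    obtain ⟨j, hj, h1, h2⟩ := hband l hl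
    rcases hWb j with h | h
    · rw [cell_eq l hl j hj]; exact h
    · exfalso
      have hsub : bandOver S' ξ j ⊆ T \ W := fun p hp => ⟨hbet j h1 h2 hp, Set.disjoint_left.1 h hp⟩
      have hne : (bandOver S' ξ j).Nonempty := by
        rw [← cell_eq l hl j hj]
        set t₀ := (u + v) / 2 with ht₀
        have ht₀I : t₀ ∈ Ioo u v := ⟨by rw [ht₀]; linarith, by rw [ht₀]; linarith⟩
        have hlt' := hlt l hl t₀ ht₀I
        refine ⟨Fin.snoc (fun _ : Fin 1 => t₀) ((bnd l t₀ + bnd (l + 1) t₀) / 2), ht₀I, ?_, ?_⟩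
        · show bnd l t₀ < (bnd l t₀ + bnd (l + 1) t₀) / 2
          linarith
        · show (bnd l t₀ + bnd (l + 1) t₀) / 2 < bnd (l + 1) t₀
          linarith
      have hpos := IsOpen.measure_pos volume (isOpen_bandOver hS'open hcont j) hne
      exact (ne_of_gt hpos) (measure_mono_null hsub hnull)
  · -- sign
    intro l hl
    obtain ⟨j, hj, -, -⟩ := hband l hl
    rw [cell_eq l hl j hj]
    rcases hPb j with hP | hP
    · exact Or.inl hP
    rcases hNb j with hN | hN
    · exact Or.inr (Or.inl hN)
    · exact Or.inr (Or.inr ⟨hP, hN⟩)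
  · -- the cells cover `T` over the strip up to the graphs
    have hcover : {p : Fin 2 → ℝ | p 0 ∈ Ioo u v ∧ 0 < p 1 ∧ p 0 + p 1 < 1} \
        (⋃ (l : ℕ) (_ : l < L), {p : Fin 2 → ℝ | p 0 ∈ Ioo u v ∧ bnd l (p 0) < p 1 ∧ p 1 < bnd (l + 1) (p 0)}) ⊆
        ⋃ j : Fin n, graphOver S' (ξ j) := by
      rintro p ⟨⟨hp0, hp1, hp2⟩, hnot⟩
      have hz : (Fin.init p) 0 ∈ Ioo u v := by rw [hinit]; exact hp0
      rcases hpart (Fin.init p) hz (p 1) with ⟨j, hj⟩ | ⟨j, hlow, hup⟩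
      · exact mem_iUnion.2 ⟨j, hz, hj⟩
      · exfalso
        have hm := (hmono _ hz).monotone
        -- the band lies between the two bounding sections
        have h1 : (j0 : ℕ) + 1 ≤ j := by
          by_contra hlt'
          have hjle : (j : ℕ) ≤ j0 := by omega
          have hnel : j ≠ Fin.last n := fun h => by rw [h, Fin.val_last] at hjle; omega
          rw [bandUpper_of_ne_last ξ j hnel, EReal.coe_lt_coe_iff] at hup
          have hle : ξ (j.castPred hnel) (Fin.init p) ≤ ξ j0 (Fin.init p) :=
            hm (Fin.le_def.2 (by rw [Fin.coe_castPred]; exact hjle))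
          rw [hξ0 _ hz] at hle
          linarith
        have h2 : (j : ℕ) ≤ j1 := by
          by_contra hlt'
          have hjge : (j1 : ℕ) + 1 ≤ j := by omega
          have hne0 : j ≠ 0 := fun h => by rw [h] at hjge; simp at hjge
          rw [bandLower_of_ne_zero ξ j hne0, EReal.coe_lt_coe_iff] at hlow
          have hle : ξ j1 (Fin.init p) ≤ ξ (j.pred hne0) (Fin.init p) :=
            hm (Fin.le_def.2 (by rw [Fin.val_pred]; omega))
          rw [hξ1 _ hz, hinit] at hle
          rw [hinit] at hlow
          simp only at hle
          linarith
        set l : ℕ := j - j0 - 1 with hl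
        have hlL : l < L := by omega
        have hjl : (j : ℕ) = j0 + l + 1 := by omega
        refine hnot (mem_iUnion₂.2 ⟨l, hlL, ?_⟩)
        rw [cell_eq l hlL j hjl, mem_bandOver_iff]
        exact ⟨hz, hlow, hup⟩
    refine measure_mono_null hcover (measure_iUnion_null fun j => ?_)
    exact KZ.volume_graph_eq_zero (hsa j)

end Summit.KontsevichZagierPeriods.SymplecticScissors.PlanarCompilerProof
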